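import Summits.QuantumFields.YangMills.Theorems.AllWindowsColdBoxBoxHighLineGhostQuadForm
import Summits.QuantumFields.YangMills.Theorems.AllWindowsColdBoxBoxHighLineTripleBond

/-!
# T-S5.7d input: DECAY of the ghost pairing `tr (X_ε · X_ε')` between two single-edge link fields
# (STUB-PLAN-S5-STEP2 §8 «`M_H` has entries `≲ G(e,e′)²`, ✓T-S5.9 `ghostKernelDecay`»; planner ym-idea-2 g18 routing 2026-08-29T19:46:09Z (iii);
# LINE-19 S5 ⟨stmt-QuantumFields-24004⟩/⟨24335⟩)

Width seat `ym-line-sfw-p2-w3` (g40).  For a link field supported on ONE cold-box edge `ε` (`GhostFP.edgeMat ε M`) the Faddeev–Popov matrix has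
non-zero rows only at the two endpoints of `ε` (`abs_fpGen_edgeMat_le`, weight `endInd ε`), so `X_ε = F₁⁻¹·fpGen (edgeMat ε M)` has entries
`|X_ε (y,b)(x,c)| ≤ 3‖M‖ Σ_z G(y,z)·nbW z x·endInd ε z` (`abs_ghostX_edgeMat_le`).  With the Coulomb decay `0 ≤ G(x,z) ≤ C_G/(1+d(x,z))²`
(✓`ghostKernelDecay`) and the nearest-neighbour transfer `d(w,p) ≤ 1 ⇒ (1+d(p,z))⁻² ≤ 4(1+d(z,w))⁻²`, the pairing of two such fields decays:

  ★ `abs_trace_ghostX_edgeMat_mul_le`:  `|tr (X_ε X_ε')| ≤ 331776·‖M‖‖M′‖·C_G² · Σ_{z,w} endInd ε z · endInd ε′ w / (1 + d(z,w))⁴`,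

and the single trace is bounded: `|tr X_ε| ≤ 288·C_G·‖M‖` (`abs_trace_ghostX_edgeMat_le`).

Everything proved; one bookkeeping definition (`endInd`); standard axioms.  HONEST LABEL: an input of ONE brick (7d) of STEP 2 of the XL stub S5 of a
critic-PASSed DRAFT line; 7d, S5, U5, ⟨24004⟩ ⟨24335⟩ ⟨24336⟩ remain OPEN; no crux, rung or summit is proved; **the Yang–Mills mass gap is NOT proved
by this file.**
-/

set_option autoImplicit false

noncomputable section

open Matrix Finset
open scoped Matrix.Norms.Operator Kronecker
open Literature.MathematicalPhysics.QuantumFieldTheory.Balaban1983to89.B10Eq18SigmaSU2 (su2Coord)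
open Literature.MathematicalPhysics.QuantumFieldTheory.AxialGauge (boxEdges)
open Literature.MathematicalPhysics.QuantumLattice (LGConfig ZdEdge)
open Literature.Probability.LatticeModels (Site dirichletMatrix)

namespace Summit.QuantumFields.YangMills.Theorems.AllWindowsColdBoxBoxHighLine

namespace GhostFP

open OrbitMapSurj (fpOperator_one_inv)
open LandauBall (in_mem_boxEdges out_mem_boxEdges)
open CubeTwoCentre (abs_sub_le_siteDist siteDist_le_of_forall siteDist_triangle)
open EdgeChartGaussian (siteDist_comm)

variable {H : ℕ}

/-! ## §1 Single-edge link fields -/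

/-- The endpoint weight of the edge `ε`: `[z = ε₋] + [z = ε₊]`. -/
def endInd (ε : ZdEdge 4) (z : Site 4) : ℝ := (if z = ε.1 then 1 else 0) + (if z = ε.1 + Pi.single ε.2 1 then 1 else 0)

/-- `0 ≤ endInd ε z`. -/
theorem endInd_nonneg (ε : ZdEdge 4) (z : Site 4) : 0 ≤ endInd ε z := by
  unfold endInd; split_ifs <;> norm_num

/-- `Σ_{z interior} endInd ε z ≤ 2`. -/
theorem sum_endInd_le (ε : ZdEdge 4) : ∑ z : ↥(interiorSites H), endInd ε (z : Site 4) ≤ 2 := by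
  unfold endInd
  rw [Finset.sum_add_distrib]
  have h1 := sum_ite_eq_le_one (H := H) (fun z => z) (fun a b h => h) ε.1
  have h2 := sum_ite_eq_le_one (H := H) (fun z => z) (fun a b h => h) (ε.1 + Pi.single ε.2 1)
  beta_reduce at h1 h2
  linarith

/-- If `endInd ε z ≠ 0` then `z` is an endpoint of `ε`, hence within sup-distance `1` of `ε₋`. -/
theorem siteDist_le_one_of_endInd_ne_zero {ε : ZdEdge 4} {z : Site 4} (h : endInd ε z ≠ 0) : siteDist z ε.1 ≤ 1 := by
  unfold endInd at h
  have hz : z = ε.1 ∨ z = ε.1 + Pi.single ε.2 1 := by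
    by_contra hn
    push Not at hn
    rw [if_neg hn.1, if_neg hn.2] at h
    exact h (by norm_num)
  refine siteDist_le_of_forall z ε.1 fun k => ?_
  rcases hz with rfl | rfl
  · simp
  · by_cases hk : k = ε.2
    · subst hk; simp
    · simp [Pi.single_eq_of_ne hk]

/-- If `nbW x y ≠ 0` then `x` and `y` are within sup-distance `1`. -/
theorem siteDist_le_one_of_nbW_ne_zero {x y : Site 4} (h : nbW x y ≠ 0) : siteDist x y ≤ 1 := by
  refine siteDist_le_of_forall x y fun k => ?_
  by_contra hk
  push Not at hk
  refine h (nbW_eq_zero_of_far ⟨k, ?_⟩)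
  have : (1 : ℝ) < |((x k - y k : ℤ) : ℝ)| := hk
  exact_mod_cast this

/-- Norm of a single-edge link field. -/
theorem norm_edgeMat_le (ε : ZdEdge 4) (M : Matrix (Fin 2) (Fin 2) ℂ) (e : ZdEdge 4) : ‖edgeMat ε M e‖ ≤ ‖M‖ := by
  unfold edgeMat; split_ifs <;> simp

/-- Rows of the Faddeev–Popov matrix of a single-edge field away from the endpoints vanish. -/
theorem fpGen_edgeMat_eq_zero (ε : ZdEdge 4) (M : Matrix (Fin 2) (Fin 2) ℂ) (r q : ↥(interiorSites H) × Fin 3)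
    (h1 : (r.1 : Site 4) ≠ ε.1) (h2 : (r.1 : Site 4) ≠ ε.1 + Pi.single ε.2 1) : fpGen H (edgeMat ε M) r q = 0 := by
  rw [fpGen_apply_eq_sum]
  refine Finset.sum_eq_zero fun μ _ => ?_
  have hin : edgeMat ε M ((r.1 : Site 4) - Pi.single μ 1, μ) = 0 := by
    unfold edgeMat
    rw [if_neg]
    intro h
    apply h2
    have h' := congrArg Prod.fst h
    have h'' := congrArg Prod.snd h
    simp only at h' h''
    rw [← h', ← h'', sub_add_cancel]
  have hout : edgeMat ε M ((r.1 : Site 4), μ) = 0 := by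
    unfold edgeMat
    rw [if_neg]
    intro h
    exact h1 (congrArg Prod.fst h)
  simp [linkLinM, hin, hout, imVecM_zero]

/-- **Entry bound for a single-edge field**: `|fpGen (edgeMat ε M) (z,d) (x,c)| ≤ 3‖M‖ · nbW z x · endInd ε z`. -/
theorem abs_fpGen_edgeMat_le (ε : ZdEdge 4) (M : Matrix (Fin 2) (Fin 2) ℂ) (r q : ↥(interiorSites H) × Fin 3) :
    |fpGen H (edgeMat ε M) r q| ≤ 3 * ‖M‖ * nbW (r.1 : Site 4) (q.1 : Site 4) * endInd ε (r.1 : Site 4) := by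
  by_cases h : (r.1 : Site 4) = ε.1 ∨ (r.1 : Site 4) = ε.1 + Pi.single ε.2 1
  · have hind : 1 ≤ endInd ε (r.1 : Site 4) := by
      unfold endInd
      rcases h with h | h <;> simp only [h, if_true] <;> split_ifs <;> norm_num
    have hb := abs_fpGen_le (H := H) (edgeMat ε M) (fun e _ => norm_edgeMat_le ε M e) r q
    have h0 : 0 ≤ 3 * ‖M‖ * nbW (r.1 : Site 4) (q.1 : Site 4) := by
      have := nbW_nonneg (r.1 : Site 4) (q.1 : Site 4); positivity
    calc |fpGen H (edgeMat ε M) r q| ≤ 3 * ‖M‖ * nbW (r.1 : Site 4) (q.1 : Site 4) * 1 := by rw [mul_one]; exact hb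
      _ ≤ _ := mul_le_mul_of_nonneg_left hind h0
  · push Not at h
    rw [fpGen_edgeMat_eq_zero ε M r q h.1 h.2, abs_zero]
    have := nbW_nonneg (r.1 : Site 4) (q.1 : Site 4)
    have := endInd_nonneg ε (r.1 : Site 4)
    positivity

/-! ## §2 Entries of `X_ε` -/

/-- **`|X_ε (y,b)(x,c)| ≤ 3‖M‖ · Σ_z G(y,z) · nbW z x · endInd ε z`.** -/
theorem abs_ghostX_edgeMat_le (hG0 : ∀ x z : ↥(interiorSites H), 0 ≤ (dirichletMatrix (interiorSites H))⁻¹ x z)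
    (ε : ZdEdge 4) (M : Matrix (Fin 2) (Fin 2) ℂ) (p q : ↥(interiorSites H) × Fin 3) :
    |ghostX H (edgeMat ε M) p q| ≤ 3 * ‖M‖ * ∑ z : ↥(interiorSites H),
      (dirichletMatrix (interiorSites H))⁻¹ p.1 z * nbW (z : Site 4) (q.1 : Site 4) * endInd ε (z : Site 4) := by
  rw [ghostX, Matrix.mul_apply, fpOperator_one_inv]
  calc |∑ r, (-((dirichletMatrix (interiorSites H))⁻¹ ⊗ₖ pauliPerm)) p r * fpGen H (edgeMat ε M) r q|
      ≤ ∑ r, |(-((dirichletMatrix (interiorSites H))⁻¹ ⊗ₖ pauliPerm)) p r * fpGen H (edgeMat ε M) r q| := Finset.abs_sum_le_sum_abs _ _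
    _ ≤ ∑ r : ↥(interiorSites H) × Fin 3, (dirichletMatrix (interiorSites H))⁻¹ p.1 r.1 * |pauliPerm p.2 r.2| *
          (3 * ‖M‖ * nbW (r.1 : Site 4) (q.1 : Site 4) * endInd ε (r.1 : Site 4)) := Finset.sum_le_sum fun r _ => by
        rw [abs_mul, Matrix.neg_apply, abs_neg, Matrix.kroneckerMap_apply, abs_mul, abs_of_nonneg (hG0 _ _)]
        exact mul_le_mul_of_nonneg_left (abs_fpGen_edgeMat_le ε M r q) (mul_nonneg (hG0 _ _) (abs_nonneg _))
    _ = 3 * ‖M‖ * ∑ z : ↥(interiorSites H),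
          (dirichletMatrix (interiorSites H))⁻¹ p.1 z * nbW (z : Site 4) (q.1 : Site 4) * endInd ε (z : Site 4) := by
        rw [Fintype.sum_prod_type, Finset.mul_sum]
        refine Finset.sum_congr rfl fun z _ => ?_
        have : ∑ d : Fin 3, (dirichletMatrix (interiorSites H))⁻¹ p.1 z * |pauliPerm p.2 d| *
            (3 * ‖M‖ * nbW (z : Site 4) (q.1 : Site 4) * endInd ε (z : Site 4)) =
            (dirichletMatrix (interiorSites H))⁻¹ p.1 z * (3 * ‖M‖ * nbW (z : Site 4) (q.1 : Site 4) * endInd ε (z : Site 4)) *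
              ∑ d : Fin 3, |pauliPerm p.2 d| := by
          rw [Finset.mul_sum]; exact Finset.sum_congr rfl fun d _ => by ring
        rw [this, pauliPerm_row_abs, mul_one]; ring

/-! ## §3 Decay transfer to a neighbour -/

/-- If `w` is within sup-distance `1` of `p` then `(1 + d(p,z))⁻² ≤ 4·(1 + d(z,w))⁻²`. -/
theorem inv_sq_le_four_of_near {p z w : Site 4} (hpw : siteDist w p ≤ 1) :
    1 / (1 + siteDist p z) ^ 2 ≤ 4 / (1 + siteDist z w) ^ 2 := by
  have h1 : siteDist z w ≤ siteDist p z + siteDist p w := siteDist_triangle p z w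
  have h2 : siteDist p w ≤ 1 := by rw [siteDist_comm]; exact hpw
  have h0 : 0 ≤ siteDist p z := GhostKernel.siteDist_nonneg _ _
  have h0' : 0 ≤ siteDist z w := GhostKernel.siteDist_nonneg _ _
  rw [div_le_div_iff₀ (by positivity) (by positivity)]
  nlinarith [h1, h2, h0, h0']

/-- The decay of `G` transferred to a neighbour: `G(p,z)·nbW w p ≤ 4C_G (1+d(z,w))⁻² · nbW w p`. -/
theorem green_mul_nbW_le {CG : ℝ} (hCG : 0 ≤ CG)
    (hGd : ∀ x z : ↥(interiorSites H), (dirichletMatrix (interiorSites H))⁻¹ x z ≤ CG / (1 + siteDist (x : Site 4) (z : Site 4)) ^ 2)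
    (p z w : ↥(interiorSites H)) :
    (dirichletMatrix (interiorSites H))⁻¹ p z * nbW (w : Site 4) (p : Site 4) ≤
      4 * CG / (1 + siteDist (z : Site 4) (w : Site 4)) ^ 2 * nbW (w : Site 4) (p : Site 4) := by
  by_cases h : nbW (w : Site 4) (p : Site 4) = 0
  · rw [h, mul_zero, mul_zero]
  · have hd := siteDist_le_one_of_nbW_ne_zero h
    refine mul_le_mul_of_nonneg_right ?_ (nbW_nonneg _ _)
    calc (dirichletMatrix (interiorSites H))⁻¹ p z ≤ CG / (1 + siteDist (p : Site 4) (z : Site 4)) ^ 2 := hGd p z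
      _ = CG * (1 / (1 + siteDist (p : Site 4) (z : Site 4)) ^ 2) := by ring
      _ ≤ CG * (4 / (1 + siteDist (z : Site 4) (w : Site 4)) ^ 2) := mul_le_mul_of_nonneg_left (inv_sq_le_four_of_near hd) hCG
      _ = 4 * CG / (1 + siteDist (z : Site 4) (w : Site 4)) ^ 2 := by ring

/-! ## §4 The pairing bound -/

/-- Row sums of `nbW` over the full index (sites × colours): `Σ_{(p₁,b)} nbW w p₁ = 3 Σ_{p₁} nbW w p₁ ≤ 48`. -/
theorem sum_prod_nbW_le (w : Site 4) : ∑ p : ↥(interiorSites H) × Fin 3, nbW w (p.1 : Site 4) ≤ 48 := by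
  rw [Fintype.sum_prod_type]
  simp only [Finset.sum_const, Finset.card_univ, Fintype.card_fin, nsmul_eq_mul]
  push_cast
  rw [← Finset.mul_sum]
  linarith [sum_nbW_right_le (H := H) w]

/-- Exchange of summation: `Σ_p Σ_q Σ_z Σ_w f z w · a z q · b w p = Σ_z Σ_w f z w · (Σ_q a z q) · (Σ_p b w p)`. -/
theorem sum_exchange {α β : Type*} [Fintype α] [Fintype β] (f : α → α → ℝ) (a b : α → β → ℝ) :
    ∑ p : β, ∑ q : β, ∑ z : α, ∑ w : α, f z w * a z q * b w p = ∑ z : α, ∑ w : α, f z w * (∑ q : β, a z q) * ∑ p : β, b w p := by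
  have h1 : ∀ p : β, ∑ q : β, ∑ z : α, ∑ w : α, f z w * a z q * b w p = ∑ z : α, ∑ w : α, ∑ q : β, f z w * a z q * b w p := by
    intro p
    rw [Finset.sum_comm]
    exact Finset.sum_congr rfl fun z _ => Finset.sum_comm
  simp only [h1]
  rw [Finset.sum_comm]
  refine Finset.sum_congr rfl fun z _ => ?_
  rw [Finset.sum_comm]
  refine Finset.sum_congr rfl fun w _ => ?_
  rw [Finset.sum_comm, mul_assoc, Finset.sum_mul_sum, Finset.mul_sum]
  refine Finset.sum_congr rfl fun q _ => ?_
  rw [Finset.mul_sum]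
  exact Finset.sum_congr rfl fun p _ => by ring

/-- Per-entry product bound for two single-edge fields (the decay already transferred to the pair `(z, w)` of endpoints). -/
theorem abs_mul_abs_ghostX_edgeMat_le (hG0 : ∀ x z : ↥(interiorSites H), 0 ≤ (dirichletMatrix (interiorSites H))⁻¹ x z) {CG : ℝ}
    (hCG : 0 ≤ CG)
    (hGd : ∀ x z : ↥(interiorSites H), (dirichletMatrix (interiorSites H))⁻¹ x z ≤ CG / (1 + siteDist (x : Site 4) (z : Site 4)) ^ 2)
    (ε ε' : ZdEdge 4) (M M' : Matrix (Fin 2) (Fin 2) ℂ) (p q : ↥(interiorSites H) × Fin 3) :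
    |ghostX H (edgeMat ε M) p q| * |ghostX H (edgeMat ε' M') q p| ≤
      9 * ‖M‖ * ‖M'‖ * ∑ z : ↥(interiorSites H), ∑ w : ↥(interiorSites H),
        (16 * CG ^ 2 / (1 + siteDist (z : Site 4) (w : Site 4)) ^ 4 * (endInd ε (z : Site 4) * endInd ε' (w : Site 4))) *
          (nbW (z : Site 4) (q.1 : Site 4)) * (nbW (w : Site 4) (p.1 : Site 4)) := by
  set G := (dirichletMatrix (interiorSites H))⁻¹ with hG
  have hX := abs_ghostX_edgeMat_le hG0 ε M p q
  have hY := abs_ghostX_edgeMat_le hG0 ε' M' q p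
  have hA0 : 0 ≤ ∑ z : ↥(interiorSites H), G p.1 z * nbW (z : Site 4) (q.1 : Site 4) * endInd ε (z : Site 4) :=
    Finset.sum_nonneg fun z _ => mul_nonneg (mul_nonneg (hG0 _ _) (nbW_nonneg _ _)) (endInd_nonneg _ _)
  have hterm : ∀ z w : ↥(interiorSites H),
      (G p.1 z * nbW (z : Site 4) (q.1 : Site 4) * endInd ε (z : Site 4)) * (G q.1 w * nbW (w : Site 4) (p.1 : Site 4) * endInd ε' (w : Site 4)) ≤
        (16 * CG ^ 2 / (1 + siteDist (z : Site 4) (w : Site 4)) ^ 4 * (endInd ε (z : Site 4) * endInd ε' (w : Site 4))) *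
          (nbW (z : Site 4) (q.1 : Site 4)) * (nbW (w : Site 4) (p.1 : Site 4)) := by
    intro z w
    have h1 := green_mul_nbW_le hCG hGd p.1 z w
    have h2 := green_mul_nbW_le hCG hGd q.1 w z
    rw [siteDist_comm (w : Site 4) (z : Site 4)] at h2
    have hn1 := nbW_nonneg (w : Site 4) (p.1 : Site 4)
    have hn2 := nbW_nonneg (z : Site 4) (q.1 : Site 4)
    have he1 := endInd_nonneg ε (z : Site 4)
    have he2 := endInd_nonneg ε' (w : Site 4)
    have hu : 0 ≤ 4 * CG / (1 + siteDist (z : Site 4) (w : Site 4)) ^ 2 := by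
      have := GhostKernel.siteDist_nonneg (z : Site 4) (w : Site 4); positivity
    have hprod := mul_le_mul h1 h2 (mul_nonneg (hG0 _ _) hn2) (mul_nonneg hu hn1)
    calc (G p.1 z * nbW (z : Site 4) (q.1 : Site 4) * endInd ε (z : Site 4)) *
          (G q.1 w * nbW (w : Site 4) (p.1 : Site 4) * endInd ε' (w : Site 4))
        = (G p.1 z * nbW (w : Site 4) (p.1 : Site 4)) * (G q.1 w * nbW (z : Site 4) (q.1 : Site 4)) *
            (endInd ε (z : Site 4) * endInd ε' (w : Site 4)) := by ring
      _ ≤ (4 * CG / (1 + siteDist (z : Site 4) (w : Site 4)) ^ 2 * nbW (w : Site 4) (p.1 : Site 4)) *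
            (4 * CG / (1 + siteDist (z : Site 4) (w : Site 4)) ^ 2 * nbW (z : Site 4) (q.1 : Site 4)) *
            (endInd ε (z : Site 4) * endInd ε' (w : Site 4)) :=
          mul_le_mul_of_nonneg_right hprod (mul_nonneg he1 he2)
      _ = _ := by
          have hd : (1 + siteDist (z : Site 4) (w : Site 4)) ≠ 0 := by
            have := GhostKernel.siteDist_nonneg (z : Site 4) (w : Site 4); positivity
          field_simp
          ring
  calc |ghostX H (edgeMat ε M) p q| * |ghostX H (edgeMat ε' M') q p|
      ≤ (3 * ‖M‖ * ∑ z : ↥(interiorSites H), G p.1 z * nbW (z : Site 4) (q.1 : Site 4) * endInd ε (z : Site 4)) *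
        (3 * ‖M'‖ * ∑ w : ↥(interiorSites H), G q.1 w * nbW (w : Site 4) (p.1 : Site 4) * endInd ε' (w : Site 4)) :=
        mul_le_mul hX hY (abs_nonneg _) (by positivity)
    _ = 9 * ‖M‖ * ‖M'‖ * ((∑ z : ↥(interiorSites H), G p.1 z * nbW (z : Site 4) (q.1 : Site 4) * endInd ε (z : Site 4)) *
          ∑ w : ↥(interiorSites H), G q.1 w * nbW (w : Site 4) (p.1 : Site 4) * endInd ε' (w : Site 4)) := by ring
    _ = 9 * ‖M‖ * ‖M'‖ * ∑ z : ↥(interiorSites H), ∑ w : ↥(interiorSites H),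
          (G p.1 z * nbW (z : Site 4) (q.1 : Site 4) * endInd ε (z : Site 4)) *
            (G q.1 w * nbW (w : Site 4) (p.1 : Site 4) * endInd ε' (w : Site 4)) := by
        rw [Finset.sum_mul_sum]
    _ ≤ _ := by
        refine mul_le_mul_of_nonneg_left (Finset.sum_le_sum fun z _ => Finset.sum_le_sum fun w _ => hterm z w) ?_
        positivity

/-- ★ **Decay of the ghost pairing**: `|tr (X_ε X_ε')| ≤ 331776 · ‖M‖‖M′‖ · C_G² · Σ_{z,w} endInd ε z · endInd ε′ w / (1+d(z,w))⁴`. -/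
theorem abs_trace_ghostX_edgeMat_mul_le (hG0 : ∀ x z : ↥(interiorSites H), 0 ≤ (dirichletMatrix (interiorSites H))⁻¹ x z) {CG : ℝ}
    (hCG : 0 ≤ CG)
    (hGd : ∀ x z : ↥(interiorSites H), (dirichletMatrix (interiorSites H))⁻¹ x z ≤ CG / (1 + siteDist (x : Site 4) (z : Site 4)) ^ 2)
    (ε ε' : ZdEdge 4) (M M' : Matrix (Fin 2) (Fin 2) ℂ) :
    |(ghostX H (edgeMat ε M) * ghostX H (edgeMat ε' M')).trace| ≤
      331776 * ‖M‖ * ‖M'‖ * CG ^ 2 * ∑ z : ↥(interiorSites H), ∑ w : ↥(interiorSites H),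
        endInd ε (z : Site 4) * endInd ε' (w : Site 4) / (1 + siteDist (z : Site 4) (w : Site 4)) ^ 4 := by
  set X := ghostX H (edgeMat ε M)
  set Y := ghostX H (edgeMat ε' M')
  set f : ↥(interiorSites H) → ↥(interiorSites H) → ℝ := fun z w =>
    16 * CG ^ 2 / (1 + siteDist (z : Site 4) (w : Site 4)) ^ 4 * (endInd ε (z : Site 4) * endInd ε' (w : Site 4)) with hf
  have hf0 : ∀ z w, 0 ≤ f z w := fun z w => by
    have := GhostKernel.siteDist_nonneg (z : Site 4) (w : Site 4)
    have := endInd_nonneg ε (z : Site 4); have := endInd_nonneg ε' (w : Site 4)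
    positivity
  have hMM : 0 ≤ 9 * ‖M‖ * ‖M'‖ := by positivity
  rw [Matrix.trace]
  simp only [Matrix.diag_apply, Matrix.mul_apply]
  calc |∑ p, ∑ q, X p q * Y q p| ≤ ∑ p, |∑ q, X p q * Y q p| := Finset.abs_sum_le_sum_abs _ _
    _ ≤ ∑ p, ∑ q, |X p q| * |Y q p| := Finset.sum_le_sum fun p _ => (Finset.abs_sum_le_sum_abs _ _).trans (le_of_eq
        (Finset.sum_congr rfl fun q _ => abs_mul _ _))
    _ ≤ ∑ p : ↥(interiorSites H) × Fin 3, ∑ q : ↥(interiorSites H) × Fin 3,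
          9 * ‖M‖ * ‖M'‖ * ∑ z : ↥(interiorSites H), ∑ w : ↥(interiorSites H),
            f z w * nbW (z : Site 4) (q.1 : Site 4) * nbW (w : Site 4) (p.1 : Site 4) :=
        Finset.sum_le_sum fun p _ => Finset.sum_le_sum fun q _ => abs_mul_abs_ghostX_edgeMat_le hG0 hCG hGd ε ε' M M' p q
    _ = 9 * ‖M‖ * ‖M'‖ * ∑ z : ↥(interiorSites H), ∑ w : ↥(interiorSites H), f z w *
          (∑ q : ↥(interiorSites H) × Fin 3, nbW (z : Site 4) (q.1 : Site 4)) * ∑ p : ↥(interiorSites H) × Fin 3, nbW (w : Site 4) (p.1 : Site 4) := by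
        rw [← sum_exchange f (fun z (q : ↥(interiorSites H) × Fin 3) => nbW (z : Site 4) (q.1 : Site 4))
          (fun w (p : ↥(interiorSites H) × Fin 3) => nbW (w : Site 4) (p.1 : Site 4)), Finset.mul_sum]
        exact Finset.sum_congr rfl fun p _ => by rw [Finset.mul_sum]
    _ ≤ 9 * ‖M‖ * ‖M'‖ * ∑ z : ↥(interiorSites H), ∑ w : ↥(interiorSites H), f z w * 48 * 48 := by
        refine mul_le_mul_of_nonneg_left (Finset.sum_le_sum fun z _ => Finset.sum_le_sum fun w _ => ?_) hMM
        have h1 : (∑ q : ↥(interiorSites H) × Fin 3, nbW (z : Site 4) (q.1 : Site 4)) ≤ 48 := sum_prod_nbW_le _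
        have h2 : (∑ p : ↥(interiorSites H) × Fin 3, nbW (w : Site 4) (p.1 : Site 4)) ≤ 48 := sum_prod_nbW_le _
        have h10 : 0 ≤ ∑ q : ↥(interiorSites H) × Fin 3, nbW (z : Site 4) (q.1 : Site 4) := Finset.sum_nonneg fun q _ => nbW_nonneg _ _
        have h20 : 0 ≤ ∑ p : ↥(interiorSites H) × Fin 3, nbW (w : Site 4) (p.1 : Site 4) := Finset.sum_nonneg fun p _ => nbW_nonneg _ _
        have := hf0 z w
        calc f z w * (∑ q : ↥(interiorSites H) × Fin 3, nbW (z : Site 4) (q.1 : Site 4)) * ∑ p : ↥(interiorSites H) × Fin 3, nbW (w : Site 4) (p.1 : Site 4)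
            ≤ f z w * 48 * ∑ p : ↥(interiorSites H) × Fin 3, nbW (w : Site 4) (p.1 : Site 4) :=
              mul_le_mul_of_nonneg_right (mul_le_mul_of_nonneg_left h1 this) h20
          _ ≤ f z w * 48 * 48 := mul_le_mul_of_nonneg_left h2 (by positivity)
    _ = 331776 * ‖M‖ * ‖M'‖ * CG ^ 2 * ∑ z : ↥(interiorSites H), ∑ w : ↥(interiorSites H),
          endInd ε (z : Site 4) * endInd ε' (w : Site 4) / (1 + siteDist (z : Site 4) (w : Site 4)) ^ 4 := by
        rw [Finset.mul_sum, Finset.mul_sum]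
        refine Finset.sum_congr rfl fun z _ => ?_
        rw [Finset.mul_sum, Finset.mul_sum]
        refine Finset.sum_congr rfl fun w _ => ?_
        rw [hf]; ring

/-- **The single trace**: `|tr X_ε| ≤ 288 · C_G · ‖M‖` when `0 ≤ G ≤ C_G`. -/
theorem abs_trace_ghostX_edgeMat_le (hG0 : ∀ x z : ↥(interiorSites H), 0 ≤ (dirichletMatrix (interiorSites H))⁻¹ x z) {CG : ℝ}
    (hCG : 0 ≤ CG) (hGC : ∀ x z : ↥(interiorSites H), (dirichletMatrix (interiorSites H))⁻¹ x z ≤ CG)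
    (ε : ZdEdge 4) (M : Matrix (Fin 2) (Fin 2) ℂ) :
    |(ghostX H (edgeMat ε M)).trace| ≤ 288 * CG * ‖M‖ := by
  rw [Matrix.trace]
  have hM : 0 ≤ ‖M‖ := norm_nonneg _
  have hrow : ∀ p : ↥(interiorSites H) × Fin 3, |ghostX H (edgeMat ε M) p p| ≤
      3 * ‖M‖ * CG * ∑ z : ↥(interiorSites H), endInd ε (z : Site 4) * nbW (z : Site 4) (p.1 : Site 4) := by
    intro p
    refine (abs_ghostX_edgeMat_le hG0 ε M p p).trans ?_
    have hsum : ∑ z : ↥(interiorSites H), (dirichletMatrix (interiorSites H))⁻¹ p.1 z * nbW (z : Site 4) (p.1 : Site 4) * endInd ε (z : Site 4) ≤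
        ∑ z : ↥(interiorSites H), CG * (endInd ε (z : Site 4) * nbW (z : Site 4) (p.1 : Site 4)) := by
      refine Finset.sum_le_sum fun z _ => ?_
      have hn := nbW_nonneg (z : Site 4) (p.1 : Site 4)
      have he := endInd_nonneg ε (z : Site 4)
      calc (dirichletMatrix (interiorSites H))⁻¹ p.1 z * nbW (z : Site 4) (p.1 : Site 4) * endInd ε (z : Site 4)
          ≤ CG * nbW (z : Site 4) (p.1 : Site 4) * endInd ε (z : Site 4) :=
            mul_le_mul_of_nonneg_right (mul_le_mul_of_nonneg_right (hGC _ _) hn) he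
        _ = CG * (endInd ε (z : Site 4) * nbW (z : Site 4) (p.1 : Site 4)) := by ring
    calc 3 * ‖M‖ * ∑ z : ↥(interiorSites H), (dirichletMatrix (interiorSites H))⁻¹ p.1 z * nbW (z : Site 4) (p.1 : Site 4) * endInd ε (z : Site 4)
        ≤ 3 * ‖M‖ * ∑ z : ↥(interiorSites H), CG * (endInd ε (z : Site 4) * nbW (z : Site 4) (p.1 : Site 4)) :=
          mul_le_mul_of_nonneg_left hsum (by positivity)
      _ = 3 * ‖M‖ * CG * ∑ z : ↥(interiorSites H), endInd ε (z : Site 4) * nbW (z : Site 4) (p.1 : Site 4) := by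
          rw [← Finset.mul_sum]; ring
  calc |∑ p, Matrix.diag (ghostX H (edgeMat ε M)) p| ≤ ∑ p, |ghostX H (edgeMat ε M) p p| := Finset.abs_sum_le_sum_abs _ _
    _ ≤ ∑ p : ↥(interiorSites H) × Fin 3, 3 * ‖M‖ * CG * ∑ z : ↥(interiorSites H), endInd ε (z : Site 4) * nbW (z : Site 4) (p.1 : Site 4) :=
        Finset.sum_le_sum fun p _ => hrow p
    _ = 3 * ‖M‖ * CG * ∑ p : ↥(interiorSites H) × Fin 3, ∑ z : ↥(interiorSites H), endInd ε (z : Site 4) * nbW (z : Site 4) (p.1 : Site 4) := by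
        rw [← Finset.mul_sum]
    _ = 3 * ‖M‖ * CG * ∑ z : ↥(interiorSites H), endInd ε (z : Site 4) * ∑ p : ↥(interiorSites H) × Fin 3, nbW (z : Site 4) (p.1 : Site 4) := by
        congr 1
        rw [Finset.sum_comm]
        exact Finset.sum_congr rfl fun z _ => by rw [Finset.mul_sum]
    _ ≤ 3 * ‖M‖ * CG * ∑ z : ↥(interiorSites H), endInd ε (z : Site 4) * 48 := by
        refine mul_le_mul_of_nonneg_left (Finset.sum_le_sum fun z _ => ?_) (by positivity)
        exact mul_le_mul_of_nonneg_left (sum_prod_nbW_le _) (endInd_nonneg _ _)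
    _ = 3 * ‖M‖ * CG * 48 * ∑ z : ↥(interiorSites H), endInd ε (z : Site 4) := by rw [← Finset.sum_mul]; ring
    _ ≤ 3 * ‖M‖ * CG * 48 * 2 := mul_le_mul_of_nonneg_left (sum_endInd_le ε) (by positivity)
    _ = 288 * CG * ‖M‖ := by ring

end GhostFP

end Summit.QuantumFields.YangMills.Theorems.AllWindowsColdBoxBoxHighLine

end
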